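import Mathlib
import Summits.KontsevichZagierPeriods.Zeta5Search.Profile11aCellsA
import Summits.KontsevichZagierPeriods.Zeta5Search.Profile11aCellsB
import Summits.KontsevichZagierPeriods.Zeta5Search.DenomLaw.Profile15aPath
import Summits.KontsevichZagierPeriods.Zeta5Search.DenomLaw.ZeroPointCoverKit
import Summits.KontsevichZagierPeriods.Zeta5Search.DenomLaw.ZeroCoverKit
import Summits.KontsevichZagierPeriods.Zeta5Search.DenomLaw.LawA3KCoverKit
import Summits.KontsevichZagierPeriods.Zeta5Search.DenomLaw.LawA4CoverKit
import Summits.KontsevichZagierPeriods.Zeta5Search.DenomLaw.LawZACoverKit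
import Summits.KontsevichZagierPeriods.Zeta5Search.DenomLaw.PathWeightProfile
import Summits.KontsevichZagierPeriods.Zeta5Search.FlagRayDominance
import Summits.KontsevichZagierPeriods.Zeta5Search.TopFamilyFPCasLB
import HarnessLib

/-!
# ζ(5) search — the `N_p = 11` PROFILES 11a of the first period for EVERY sorted parameter vector: PATH accounting at every depth (DENOM-LAW D1, prover-d1 gen 22)

Cell `pub-zeta5` (HONEST FRAMING: systematic search; no irrationality claim unless certified), TRACK «DENOM-LAW» D1 prover seat (denom-prover-d1
gen 22, `HOME/denom-law/prover-d1/ATTEMPT-22.md` §6).  The five a = 7 profiles with exactly ten short pair blocks: 11a short = every `(i,k)` with `k ≤ 5`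
(`C⋆ ≤ 9`, new finite check `cStar_le_nine_11a`; `⌊d/p⌋ ∈ {0,1,2}`: THEOREM LB `(−5,−2)` with no hypothesis on `d` via `casLB_ge_of_cover_le0`, the LEMMA-D bonus
`m = −5` at `p ≤ d`, the ZERO-POINT law `(6; [], [[1,−6,−1,1]])` at `2p ≤ d`; node `−7 / −6 / −5`); 11b short `i ≤ 2, k ≤ 6` and `(3,4)`, 11d short `i ≤ 3, k ≤ 5` and
`(1,6)`, 11e short `(1,k)`, `(2,3),(2,4),(2,5),(3,4)` (`C⋆ ≤ 10` by gen 22's `cStar_le_ten_12b` / new `cStar_le_ten_11d` / gen 18's `cStar_le_ten_15a`; `d < 2p`; THEOREM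
LB `(−4,−1)` = `−5` = node); 11c short `(1,k)`, `(2,3),…,(2,6)` (`C⋆ ≤ 10`; THEOREM A⁗ `cover_A4` at `(6,[1,−4,−4,1])` = `−5` at `⌊d/p⌋ = 1`, THEOREM ZA `cover_ZA`
`(6; [[1,−4,−4,1]], [])` = `−4` at `⌊d/p⌋ = 2`).  Covers `FullProfile.cover11x_ev/od` (`Profile11{a,…,e}Cells{A,B}`, machine-generated; every check `decide`).
Results: `pathAccounting_profile11x` (every `j`) and **`pathAccountingFirstPeriod_profile11x`** (the node's binders VERBATIM plus `p ≤ b₇` and the profile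
inequalities; no depth hypothesis), x ∈ {a}.  Census beside the proof (gen 22, exhaustive a = 7 at p = 7, 11, 10 % sample at p = 13): 11a 6,759 · 11b 1,747
· 11c 1,343 · 11d 931 · 11e 719 instances, every one reached by exactly these rungs; 0 open at p ≤ 13 (kit j285126).
MODEL/structure-side valuation bookkeeping of the cell's own rationals; nothing about ζ(5); no γ; records in print UNMOVED.
-/

open Finset

namespace Summit.KontsevichZagierPeriods.Zeta5Search.FullProfile

open Summit.KontsevichZagierPeriods.Zeta5Search.ClusterValuation
open Summit.KontsevichZagierPeriods.Zeta5Search.CasoratianValuation (InPolytope shift casoratian pairFloors refund)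
open Summit.KontsevichZagierPeriods.Zeta5Search.WedgeDictionary (dOf)
open Summit.KontsevichZagierPeriods.Zeta5Search.ClassTypeCover
open Summit.KontsevichZagierPeriods.Zeta5Search.DenomLaw (cStar FirstPeriod Sorted7 zeroClasses_of_cover zeroBound_of_classes zeroPointBound_of_classes cover_A3K cover_A4 cover_ZA)
open Summit.KontsevichZagierPeriods.Zeta5Search.DenomLaw.FirstPeriodKit (cStar_le_eleven sorted7_chain firstPeriod_pair pairFloors_expand)
open Summit.KontsevichZagierPeriods.Zeta5Search.ZeroWindows (ZeroWindowClasses)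
open Summit.KontsevichZagierPeriods.Zeta5Search.TopFamFP (cover_J_j)
open Summit.KontsevichZagierPeriods.Zeta5Search.StairFLAG (cover_B_j)
open Summit.KontsevichZagierPeriods.Zeta5Search.SortedProfile

/-! ## THEOREM LB from a cover with a non-positive row constant (no hypothesis on `d`) -/

/-- **THEOREM LB's value from a cover without `p ≤ d`**: if the row constant is `B ≤ 0` then `A + B ≤ casLB b p` (or there is no pole class), whatever `d`. -/
theorem casLB_ge_of_cover_le0 {b : ℕ → ℤ} {p : ℕ} [Fact p.Prime] {TY : List (List ℤ × Bool)} (hcov : Cover b p TY) {A B : ℤ}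
    (hchk : checkLB (decide (¬ (2 : ℤ) ∣ b 0)) TY A B = true) (hB0 : B ≤ 0) :
    casLB b p = 0 ∨ A + B ≤ casLB b p := by
  rw [checkLB, List.all_eq_true] at hchk
  have hA : ∀ x, x < p → 1 ≤ classPoleCount b p x → A ≤ classNu b p x := by
    intro x hx h1
    obtain ⟨tc, htc, ht⟩ := hcov x hx
    have hc := hchk tc htc
    simp only [Bool.and_eq_true, Bool.or_eq_true, decide_eq_true_eq] at hc
    rw [ht.classPoleCount_eq] at h1
    rw [ht.classNu_eq]
    rcases hc.1 with h0 | hA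
    · omega
    · exact hA
  have hB : ∀ x, x < p → 2 ≤ classPoleCount b p x → B ≤ 3 + classExp b p x := by
    intro x hx h2
    obtain ⟨tc, htc, ht⟩ := hcov x hx
    have hc := hchk tc htc
    simp only [Bool.and_eq_true, Bool.or_eq_true, decide_eq_true_eq] at hc
    rw [ht.classPoleCount_eq] at h2
    rw [ht.classExp_eq]
    rcases hc.2 with h0 | hB
    · omega
    · exact hB
  rcases casLB_ge_or_noPole b p A B hA (by omega) hB (fun _ => hB0) with ⟨h0, -⟩ | h
  · exact Or.inl h0
  · exact Or.inr h


/-! ## The `N_p = 11` profile with short blocks `all (i,k) with k ≤ 5` -/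

section P11A

variable {b : ℕ → ℤ} {j p : ℕ}

/-- **`C⋆ ≤ 9` on the `N_p = 11` profile 11a** (every pair block within the five largest parameters short: long edges touch parameter 6 or 7, so a
Hamiltonian path has at most four): the finite check over the 5,040 orderings (`decide +kernel`). -/
theorem cStar_le_nine_11a {b : ℕ → ℤ} {p : ℕ} (hs : Sorted7 b) (hQ : b 0 < (p : ℤ) + b 4 + b 5) : cStar b p ≤ 9 := by
  obtain ⟨h21, h32, h43, h54, h65, h76⟩ := sorted7_chain hs
  refine DenomLaw.FirstPeriodKit.cStar_le_of_profile (fun _ => True) (fun i k => ¬ (i.val ≤ 4 ∧ k.val ≤ 4 ∧ i.val ≠ k.val)) 9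
    (fun _ _ => trivial) ?_ (by decide +kernel)
  intro i k hik h
  obtain ⟨hi, hk, hne⟩ := h
  have key : b 4 + b 5 ≤ b (i.val + 1) + b (k.val + 1) := by
    have := i.isLt; have := k.isLt
    interval_cases hv : i.val <;> interval_cases hw : k.val <;> simp only [Nat.reduceAdd] <;> omega
  linarith


/-- On this profile `d(b) < 3p`. -/
theorem d_lt_three11a (hs : Sorted7 b) (hP : (p : ℤ) ≤ b 7) (_hQ : b 0 < (p : ℤ) + b 4 + b 5) (_hQ6 : (p : ℤ) + b 1 + b 6 ≤ b 0) (hF1 : b 1 < 2 * (p : ℤ)) : dOf b < 3 * (p : ℤ) := by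
  obtain ⟨h21, h32, h43, h54, h65, h76⟩ := sorted7_chain hs
  rw [DecompositionWholeCone.dOf_expand]; linarith

/-- **`N_p = 11`** on this profile: the pair digits of the ten short blocks are `0`, the other eleven are `1`. -/
theorem pairFloors_eq_11a (hb : InPolytope b) (hs : Sorted7 b) (hp : 0 < p) (hQ : b 0 < (p : ℤ) + b 4 + b 5) (hQ6 : (p : ℤ) + b 1 + b 6 ≤ b 0) (hfp : FirstPeriod b p) : pairFloors b p = 11 := by
  obtain ⟨h21, h32, h43, h54, h65, h76⟩ := sorted7_chain hs
  obtain ⟨h0, hb1, hb2, hb3, hb4, hb5, hb6, hb7, hc1⟩ := box hb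
  have hp0 : (0 : ℤ) < p := by exact_mod_cast hp
  have one : ∀ z : ℤ, (p : ℤ) ≤ z → z ≤ 2 * (p : ℤ) - 1 → z / (p : ℤ) = 1 := fun z h1 h2 => by
    rw [Int.ediv_eq_iff_of_pos hp0]; constructor <;> linarith
  have z12 : (b 0 - b 1 - b 2) / (p : ℤ) = 0 := Int.ediv_eq_zero_of_lt (by linarith) (by linarith)
  have z13 : (b 0 - b 1 - b 3) / (p : ℤ) = 0 := Int.ediv_eq_zero_of_lt (by linarith) (by linarith)
  have z14 : (b 0 - b 1 - b 4) / (p : ℤ) = 0 := Int.ediv_eq_zero_of_lt (by linarith) (by linarith)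
  have z15 : (b 0 - b 1 - b 5) / (p : ℤ) = 0 := Int.ediv_eq_zero_of_lt (by linarith) (by linarith)
  have z23 : (b 0 - b 2 - b 3) / (p : ℤ) = 0 := Int.ediv_eq_zero_of_lt (by linarith) (by linarith)
  have z24 : (b 0 - b 2 - b 4) / (p : ℤ) = 0 := Int.ediv_eq_zero_of_lt (by linarith) (by linarith)
  have z25 : (b 0 - b 2 - b 5) / (p : ℤ) = 0 := Int.ediv_eq_zero_of_lt (by linarith) (by linarith)
  have z34 : (b 0 - b 3 - b 4) / (p : ℤ) = 0 := Int.ediv_eq_zero_of_lt (by linarith) (by linarith)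
  have z35 : (b 0 - b 3 - b 5) / (p : ℤ) = 0 := Int.ediv_eq_zero_of_lt (by linarith) (by linarith)
  have z45 : (b 0 - b 4 - b 5) / (p : ℤ) = 0 := Int.ediv_eq_zero_of_lt (by linarith) (by linarith)
  have U := fun (i k : ℕ) (hi : i < 7) (hk : k < 7) (hik : i < k) => firstPeriod_pair hfp hi hk hik
  rw [pairFloors_expand, z12, z13, z14, z15, z23, z24, z25, z34, z35, z45,
    one _ (by linarith) (U 0 5 (by norm_num) (by norm_num) (by norm_num)),
    one _ (by linarith) (U 0 6 (by norm_num) (by norm_num) (by norm_num)),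
    one _ (by linarith) (U 1 5 (by norm_num) (by norm_num) (by norm_num)),
    one _ (by linarith) (U 1 6 (by norm_num) (by norm_num) (by norm_num)),
    one _ (by linarith) (U 2 5 (by norm_num) (by norm_num) (by norm_num)),
    one _ (by linarith) (U 2 6 (by norm_num) (by norm_num) (by norm_num)),
    one _ (by linarith) (U 3 5 (by norm_num) (by norm_num) (by norm_num)),
    one _ (by linarith) (U 3 6 (by norm_num) (by norm_num) (by norm_num)),
    one _ (by linarith) (U 4 5 (by norm_num) (by norm_num) (by norm_num)),
    one _ (by linarith) (U 4 6 (by norm_num) (by norm_num) (by norm_num)),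
    one _ (by linarith) (U 5 6 (by norm_num) (by norm_num) (by norm_num))]
  norm_num

/-- **THEOREM LB on this profile, general `b`, any depth**: `v_p(Cas_j(b)) ≥ −7 = VB + row` (`(A, B) = (−5, −2)`, `B ≤ 0` so no hypothesis on `d`;
`casLB_ge_of_cover_le0`). -/
theorem cas_ge11a_neg7 (hb : InPolytope b) (hs : Sorted7 b) (hbj : InPolytope (shift b j)) (hj1 : 1 ≤ j) (hj7 : j ≤ 7)
    (hprime : p.Prime) (hp5 : 5 ≤ p) (hwin : (b 0 + 2 : ℤ) < (p : ℤ) ^ 2) (hP : (p : ℤ) ≤ b 7) (hQ : b 0 < (p : ℤ) + b 4 + b 5) (hQ6 : (p : ℤ) + b 1 + b 6 ≤ b 0)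
    (hF1 : b 1 < 2 * (p : ℤ)) (hF2 : b 0 < 2 * (p : ℤ) + b 6 + b 7) (hcas : casoratian b j ≠ 0) : (-7 : ℤ) ≤ padicValRat p (casoratian b j) := by
  haveI : Fact p.Prime := ⟨hprime⟩
  have hp2 : p % 2 = 1 := Nat.odd_iff.1 (hprime.odd_of_ne_two (by omega))
  have hv := casoratianClassBound_holds b j p hb hj1 hj7 hbj hprime hp5 hwin hcas
  rcases Int.emod_two_eq_zero_or_one (b 0) with hr | hr
  · rcases casLB_ge_of_cover_le0 (cover11a_ev hb hs hP hQ hQ6 hF1 hF2 hp5 hp2 hr) (A := -5) (B := -2) (by rw [oddFlag_false hr]; decide) (by norm_num) with h0 | h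
    · rw [h0] at hv; linarith
    · linarith
  · rcases casLB_ge_of_cover_le0 (cover11a_od hb hs hP hQ hQ6 hF1 hF2 hp5 hp2 hr) (A := -5) (B := -2) (by rw [oddFlag_true hr]; decide) (by norm_num) with h0 | h
    · rw [h0] at hv; linarith
    · linarith

/-- **The Lemma-D bonus on this profile at `p ≤ d`, general `b`**: `v_p(Cas_j(b)) ≥ −6` (`m = −5`, deep pair `[1,−6,−1,1]` / `[1,−1,−6,1]`; `TopFamFP.cover_J_j`). -/
theorem cas_ge11a_neg6 (hb : InPolytope b) (hs : Sorted7 b) (hbj : InPolytope (shift b j)) (hj1 : 1 ≤ j) (hj7 : j ≤ 7)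
    (hprime : p.Prime) (hp5 : 5 ≤ p) (hwin : (b 0 + 2 : ℤ) < (p : ℤ) ^ 2) (hP : (p : ℤ) ≤ b 7) (hQ : b 0 < (p : ℤ) + b 4 + b 5) (hQ6 : (p : ℤ) + b 1 + b 6 ≤ b 0)
    (hF1 : b 1 < 2 * (p : ℤ)) (hF2 : b 0 < 2 * (p : ℤ) + b 6 + b 7) (hpd : (p : ℤ) ≤ dOf b) (hcas : casoratian b j ≠ 0) : (-6 : ℤ) ≤ padicValRat p (casoratian b j) := by
  haveI : Fact p.Prime := ⟨hprime⟩
  have hp2 : p % 2 = 1 := Nat.odd_iff.1 (hprime.odd_of_ne_two (by omega))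
  obtain ⟨h21, h32, h43, h54, h65, h76⟩ := sorted7_chain hs
  obtain ⟨h0, hb1, hb2, hb3, hb4, hb5, hb6, hb7, hc1⟩ := box hb
  have hpb : (p : ℤ) ≤ b 0 := by linarith
  rcases Int.emod_two_eq_zero_or_one (b 0) with hr | hr
  · exact cover_J_j hb hj1 hj7 hbj hprime hp5 hpb hpd hwin (cover11a_ev hb hs hP hQ hQ6 hF1 hF2 hp5 hp2 hr) (m := -5) (B := -2) (A' := -4) (B' := -1) (c := -6)
      (by rw [oddFlag_false hr]; decide) (by norm_num) (by rw [oddFlag_false hr]; decide) (by rw [oddFlag_false hr]; decide)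
      (by norm_num) (by norm_num) (by norm_num) (by norm_num) hcas
  · exact cover_J_j hb hj1 hj7 hbj hprime hp5 hpb hpd hwin (cover11a_od hb hs hP hQ hQ6 hF1 hF2 hp5 hp2 hr) (m := -5) (B := -2) (A' := -4) (B' := -1) (c := -6)
      (by rw [oddFlag_true hr]; decide) (by norm_num) (by rw [oddFlag_true hr]; decide) (by rw [oddFlag_true hr]; decide)
      (by norm_num) (by norm_num) (by norm_num) (by norm_num) hcas

/-- **The ZERO-POINT law on this profile at `2p ≤ d`, general `b`**: `v_p(Cas_j(b)) ≥ −5 = 7 − 2M` at `M = 6` (one-point structure `(6; [], [[1,−6,−1,1]])`). -/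
theorem cas_ge11a_neg5 (hb : InPolytope b) (hs : Sorted7 b) (hbj : InPolytope (shift b j)) (hj1 : 1 ≤ j) (hj7 : j ≤ 7)
    (hprime : p.Prime) (hp5 : 5 ≤ p) (hwin : (b 0 + 2 : ℤ) < (p : ℤ) ^ 2) (hP : (p : ℤ) ≤ b 7) (hQ : b 0 < (p : ℤ) + b 4 + b 5) (hQ6 : (p : ℤ) + b 1 + b 6 ≤ b 0)
    (hF1 : b 1 < 2 * (p : ℤ)) (hF2 : b 0 < 2 * (p : ℤ) + b 6 + b 7) (hd : 2 * (p : ℤ) ≤ dOf b) (hcas : casoratian b j ≠ 0) : (-5 : ℤ) ≤ padicValRat p (casoratian b j) := by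
  haveI : Fact p.Prime := ⟨hprime⟩
  have hp2 : p % 2 = 1 := Nat.odd_iff.1 (hprime.odd_of_ne_two (by omega))
  obtain ⟨h21, h32, h43, h54, h65, h76⟩ := sorted7_chain hs
  obtain ⟨h0, hb1, hb2, hb3, hb4, hb5, hb6, hb7, hc1⟩ := box hb
  have hpb : (p : ℤ) ≤ b 0 := by linarith
  have hdeg : (p : ℤ) * (((6 : ℕ) : ℤ) - 2) ≤ 2 * dOf b + 1 := by push_cast; linarith
  have hD : ∀ T ∈ ([] : List (List ℤ)), T.reverse = T := by simp
  have hC : ZeroWindowClasses b p 6 [] [[1, -6, -1, 1]] := by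
    rcases Int.emod_two_eq_zero_or_one (b 0) with hr | hr
    · exact zeroClasses_of_cover h0 (cover11a_ev hb hs hP hQ hQ6 hF1 hF2 hp5 hp2 hr) (by rw [oddFlag_false hr]; decide)
    · exact zeroClasses_of_cover h0 (cover11a_od hb hs hP hQ hQ6 hF1 hF2 hp5 hp2 hr) (by rw [oddFlag_true hr]; decide)
  have h := zeroPointBound_of_classes hb hbj hj1 hj7 hprime hp5 hpb hwin (M := 6) (by norm_num) (by decide) hD (by decide) hC hdeg hcas
  simpa using h

/-- **`PathAccountingFirstPeriod`'s conclusion on this `N_p = 11` profile (short blocks: every pair within the five largest parameters), EVERY sorted `b`,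
every direction `j`, every depth** (`C⋆ ≤ 9`, `cStar_le_nine_11a`: the node asks `−7 / −6 / −5` at `⌊d/p⌋ = 0 / 1 / 2`; `d < 3p`). -/
theorem pathAccounting_profile11a (b : ℕ → ℤ) (j p : ℕ) (hb : InPolytope b) (hs : Sorted7 b) (hbj : InPolytope (shift b j))
    (hj1 : 1 ≤ j) (hj7 : j ≤ 7) (hprime : p.Prime) (hp5 : 5 ≤ p) (hwin : (b 0 + 2 : ℤ) < (p : ℤ) ^ 2) (hfp : FirstPeriod b p)
    (hP : (p : ℤ) ≤ b 7) (hQ : b 0 < (p : ℤ) + b 4 + b 5) (hQ6 : (p : ℤ) + b 1 + b 6 ≤ b 0)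
    (hcas : casoratian b j ≠ 0) :
    dOf b / (p : ℤ) - pairFloors b p - min (if 2 ≤ dOf b / (p : ℤ) then (1 : ℤ) else 0) (5 - (cStar b p : ℤ))
      ≤ padicValRat p (casoratian b j) := by
  obtain ⟨hF1, hF2⟩ := fp_bounds hfp
  have hp0 : (0 : ℤ) < p := by exact_mod_cast hprime.pos
  rw [pairFloors_eq_11a hb hs hprime.pos hQ hQ6 hfp]
  have hC9 : (cStar b p : ℤ) ≤ 9 := by exact_mod_cast cStar_le_nine_11a hs hQ
  have hfd3 : dOf b / (p : ℤ) < 3 := by rw [Int.ediv_lt_iff_lt_mul hp0]; linarith [d_lt_three11a hs hP hQ hQ6 hF1]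
  by_cases h2 : 2 * (p : ℤ) ≤ dOf b
  · have hfd : 2 ≤ dOf b / (p : ℤ) := by rw [Int.le_ediv_iff_mul_le hp0]; linarith
    rw [if_pos hfd]
    have hmin' : -4 ≤ min (1 : ℤ) (5 - (cStar b p : ℤ)) := le_min (by norm_num) (by linarith)
    linarith [cas_ge11a_neg5 hb hs hbj hj1 hj7 hprime hp5 hwin hP hQ hQ6 hF1 hF2 h2 hcas]
  · push Not at h2
    have hfd : dOf b / (p : ℤ) < 2 := by rw [Int.ediv_lt_iff_lt_mul hp0]; linarith
    rw [if_neg (by omega)]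
    have hmin' : -4 ≤ min (0 : ℤ) (5 - (cStar b p : ℤ)) := le_min (by norm_num) (by linarith)
    by_cases h1 : (p : ℤ) ≤ dOf b
    · linarith [cas_ge11a_neg6 hb hs hbj hj1 hj7 hprime hp5 hwin hP hQ hQ6 hF1 hF2 h1 hcas]
    · push Not at h1
      obtain ⟨h21, h32, h43, h54, h65, h76⟩ := sorted7_chain hs
      have hd0 : 0 ≤ dOf b := by rw [DecompositionWholeCone.dOf_expand]; linarith [hb.2.2]
      have hfd0 : dOf b / (p : ℤ) = 0 := Int.ediv_eq_zero_of_lt hd0 h1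
      rw [hfd0]
      linarith [cas_ge11a_neg7 hb hs hbj hj1 hj7 hprime hp5 hwin hP hQ hQ6 hF1 hF2 hcas]

/-- **THE NODE ON THIS `N_p = 11` PROFILE, EVERY SORTED `b`, EVERY DEPTH: `PathAccountingFirstPeriod` with its binders VERBATIM plus `p ≤ b₇` and the profile
inequalities.** -/
theorem pathAccountingFirstPeriod_profile11a :
    ∀ (b : ℕ → ℤ) (p : ℕ), InPolytope b → Sorted7 b → InPolytope (shift b 7) →
      p.Prime → 5 ≤ p → (b 0 + 2 : ℤ) < (p : ℤ) ^ 2 → FirstPeriod b p →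
      (p : ℤ) ≤ b 7 → b 0 < (p : ℤ) + b 4 + b 5 → (p : ℤ) + b 1 + b 6 ≤ b 0 → casoratian b 7 ≠ 0 →
        dOf b / (p : ℤ) - pairFloors b p - min (if 2 ≤ dOf b / (p : ℤ) then (1 : ℤ) else 0) (5 - (cStar b p : ℤ))
          ≤ padicValRat p (casoratian b 7) :=
  fun b p hb hs hb7 hprime hp5 hwin hfp hP hQ hQ6 hcas =>
    pathAccounting_profile11a b 7 p hb hs hb7 (by norm_num) (by norm_num) hprime hp5 hwin hfp hP hQ hQ6 hcas

end P11A

end Summit.KontsevichZagierPeriods.Zeta5Search.FullProfile
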